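import Mathlib
import Literature.AlgebraicGeometry.Resolution.ResolutionOfSingularities
import Literature.AlgebraicGeometry.Resolution.ResolutionGlue
import Summits.ResolutionOfSingularities.ResolutionOfSingularities.Theorems.FrobeniusLadderFRationalResolutionModelOpenGlue
import Summits.ResolutionOfSingularities.ResolutionOfSingularities.Theorems.FrobeniusLadderFRationalResolutionResolutionLocal
import HarnessLib

/-!
# Proper models with a Zariski-local property glue point by point
(crux `FrobeniusLadder.FRationalResolution`, line `Sketch`)

Stub `stub_model_of_local_models` of the skeleton `Sketch` for crux
stmt-ResolutionOfSingularities-15317. Let `P` be a property of schemes which glues along two-piece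
open covers (`hPglue`). Let `U ⊆ X` be an open whose open subscheme satisfies `P`, and `S ⊆ X` a
finite set of points with `X = U ∪ S`; suppose every `s ∈ S` has an open neighbourhood `V ∋ s`
meeting `S` only in `s` and carrying a local model `ρ : Y → V` (proper, `P Y`, an isomorphism over
`V ∩ U` with dense preimage). Then `X` receives a proper `π : X' → X` from a scheme satisfying `P`
which is an isomorphism over `U` with dense preimage of `U`.

This generalises `stub_hasResolution_of_local_resolutions` (`…ResolutionLocal.lean`, the case
`P = Scheme.IsRegular`), whose proof is repeated verbatim: induction over the finite set
(`Finset.induction_on'`), growing a modelled open `O = U ∪ T` (`T ⊆ S`) together with a proper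
`X_T → O` from a scheme satisfying `P` which is an isomorphism over `O ∩ U` with dense preimage.
The base case is the identity of `U`; the step `T ↦ insert s T` glues the model of `O` with the
local model of `V ∋ s` over the open subscheme `O ∪ V` by the landed symmetric two-open glue
`stub_model_glue2` (`…ModelOpenGlue.lean`): the overlap `O ∩ V` lies in `U` because `V ∩ S = {s}`
and `s ∉ T`. Finally `O = U ∪ S = X`, and we compose with the isomorphism `⊤.ι : ↑⊤ ⟶ X`.
-/

set_option linter.dupNamespace false

noncomputable section

open CategoryTheory CategoryTheory.Limits AlgebraicGeometry TopologicalSpace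
  Literature.AlgebraicGeometry.Resolution

namespace Summit.ResolutionOfSingularities.ResolutionOfSingularities.Theorems.FRationalResolution

/-- Gluing step over two opens of a fixed scheme, for a property `P` of schemes gluing along
two-piece open covers. Let `U, O, V ⊆ X` be opens with `O ∩ V ⊆ U`. If the open subschemes `O`
and `V` both receive proper morphisms from schemes satisfying `P` which are isomorphisms over
`O ∩ U` resp. `V ∩ U` with dense preimages, then so does `O ∪ V` (over `(O ∪ V) ∩ U`): apply
`stub_model_glue2` to the open cover of `↑(O ⊔ V)` by `X.homOfLE _ : ↑O ⟶ ↑(O ⊔ V)` and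
`X.homOfLE _ : ↑V ⟶ ↑(O ⊔ V)` with `W := (O ⊔ V).ι ⁻¹ U`. [folklore] -/
theorem exists_model_sup_of_inf_le (P : Scheme.{0} → Prop)
    (hPglue : ∀ (Z U Y : Scheme.{0}) (i : U ⟶ Z) (j : Y ⟶ Z) [IsOpenImmersion i]
      [IsOpenImmersion j], i.opensRange ⊔ j.opensRange = ⊤ → P U → P Y → P Z)
    (X : Scheme.{0}) (U O V : X.Opens) (hOV : O ⊓ V ≤ U)
    (hO : ∃ (A' : Scheme.{0}) (α : A' ⟶ (O : Scheme.{0})), IsProper α ∧ P A' ∧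
      IsIso (α ∣_ (O.ι ⁻¹ᵁ U)) ∧ Dense ((α ⁻¹ᵁ (O.ι ⁻¹ᵁ U) : A'.Opens) : Set A'))
    (hV : ∃ (B' : Scheme.{0}) (β : B' ⟶ (V : Scheme.{0})), IsProper β ∧ P B' ∧
      IsIso (β ∣_ (V.ι ⁻¹ᵁ U)) ∧ Dense ((β ⁻¹ᵁ (V.ι ⁻¹ᵁ U) : B'.Opens) : Set B')) :
    ∃ (X' : Scheme.{0}) (π : X' ⟶ ((O ⊔ V : X.Opens) : Scheme.{0})), IsProper π ∧
      P X' ∧ IsIso (π ∣_ ((O ⊔ V).ι ⁻¹ᵁ U)) ∧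
      Dense ((π ⁻¹ᵁ ((O ⊔ V).ι ⁻¹ᵁ U) : X'.Opens) : Set X') := by
  obtain ⟨A', α, hαp, hA', hα, hαd⟩ := hO
  obtain ⟨B', β, hβp, hB', hβ, hβd⟩ := hV
  haveI := hαp
  haveI := hβp
  -- the two open immersions covering `↑(O ⊔ V)`
  set iA : (O : Scheme.{0}) ⟶ ((O ⊔ V : X.Opens) : Scheme.{0}) :=
    X.homOfLE (le_sup_left : O ≤ O ⊔ V) with hiA
  set iB : (V : Scheme.{0}) ⟶ ((O ⊔ V : X.Opens) : Scheme.{0}) :=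
    X.homOfLE (le_sup_right : V ≤ O ⊔ V) with hiB
  set W : ((O ⊔ V : X.Opens) : Scheme.{0}).Opens := (O ⊔ V).ι ⁻¹ᵁ U with hW_def
  have eA : iA ⁻¹ᵁ W = O.ι ⁻¹ᵁ U := by
    rw [hW_def, hiA, ← Scheme.Hom.comp_preimage, Scheme.homOfLE_ι]
  have eB : iB ⁻¹ᵁ W = V.ι ⁻¹ᵁ U := by
    rw [hW_def, hiB, ← Scheme.Hom.comp_preimage, Scheme.homOfLE_ι]
  -- (`iA`, `iB` are local definitions: `Scheme.opensRange_homOfLE` applies up to unfolding)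
  have hrA : iA.opensRange = (O ⊔ V).ι ⁻¹ᵁ O := Scheme.opensRange_homOfLE _
  have hrB : iB.opensRange = (O ⊔ V).ι ⁻¹ᵁ V := Scheme.opensRange_homOfLE _
  have hcover : iA.opensRange ⊔ iB.opensRange = ⊤ := by
    rw [hrA, hrB]
    refine top_le_iff.mp fun x _ => ?_
    have hx : x.1 ∈ O ⊔ V := x.2
    rcases Opens.mem_sup.mp hx with h | h
    · exact Opens.mem_sup.mpr (Or.inl h)
    · exact Opens.mem_sup.mpr (Or.inr h)
  have hWle : iA.opensRange ⊓ iB.opensRange ≤ W := by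
    rw [hrA, hrB, hW_def]
    intro x hx
    exact hOV (Opens.mem_inf.mpr ⟨(Opens.mem_inf.mp hx).1, (Opens.mem_inf.mp hx).2⟩)
  have hα' : IsIso (α ∣_ (iA ⁻¹ᵁ W)) := by
    rw [eA]
    exact hα
  have hαd' : Dense ((α ⁻¹ᵁ (iA ⁻¹ᵁ W) : A'.Opens) : Set A') := by
    rw [eA]
    exact hαd
  have hβ' : IsIso (β ∣_ (iB ⁻¹ᵁ W)) := by
    rw [eB]
    exact hβ
  have hβd' : Dense ((β ⁻¹ᵁ (iB ⁻¹ᵁ W) : B'.Opens) : Set B') := by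
    rw [eB]
    exact hβd
  exact stub_model_glue2 P hPglue _ _ _ A' B' iA iB hcover W hWle α hA' hα' hαd' β hB' hβ' hβd'

/-- **PROPER MODELS WITH A ZARISKI-LOCAL PROPERTY GLUE POINT BY POINT.** Let `P` be a property of
schemes gluing along two-piece open covers, `U ⊆ X` an open with `P ↑U`, and `S` a finite set of
points with `X = U ∪ S`, such that every `s ∈ S` has an open neighbourhood `V` with `V ∩ S = {s}`
carrying a proper `ρ : Y → V` from a scheme satisfying `P` which is an isomorphism over `V ∩ U`
with dense preimage. Then there is a proper `π : X' → X` with `P X'`, an isomorphism over `U` with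
dense preimage of `U`. Induction over `T ⊆ S` growing a modelled open `O = U ∪ T` (base: the
identity of `U`; step: `exists_model_sup_of_inf_le`, the overlap `O ∩ V` lying in `U` since
`V ∩ S = {s}` and `s ∉ T`); at the end `O = ⊤` and we compose with the isomorphism `⊤.ι`.
Generalises `stub_hasResolution_of_local_resolutions` (`P = Scheme.IsRegular`). [folklore] -/
theorem stub_model_of_local_models (P : Scheme.{0} → Prop)
    (hPglue : ∀ (Z U Y : Scheme.{0}) (i : U ⟶ Z) (j : Y ⟶ Z) [IsOpenImmersion i]
      [IsOpenImmersion j], i.opensRange ⊔ j.opensRange = ⊤ → P U → P Y → P Z)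
    (X : Scheme.{0}) (U : X.Opens) (hU : P (U : Scheme.{0})) (S : Finset X)
    (hcov : ∀ x : X, x ∈ U ∨ x ∈ S)
    (hloc : ∀ s ∈ S, ∃ (V : X.Opens), s ∈ V ∧ (∀ t ∈ S, t ∈ V → t = s) ∧
      ∃ (Y : Scheme.{0}) (ρ : Y ⟶ V), IsProper ρ ∧ P Y ∧
        IsIso (ρ ∣_ (V.ι ⁻¹ᵁ U)) ∧ Dense ((ρ ⁻¹ᵁ (V.ι ⁻¹ᵁ U) : Y.Opens) : Set Y)) :
    ∃ (X' : Scheme.{0}) (π : X' ⟶ X), IsProper π ∧ P X' ∧ IsIso (π ∣_ U) ∧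
      Dense ((π ⁻¹ᵁ U : X'.Opens) : Set X') := by
  classical
  -- Step 1: induction over sub-finsets `T ⊆ S`, growing a modelled open `O = U ∪ T`.
  have key : ∃ (O : X.Opens), (∀ x : X, x ∈ O ↔ x ∈ U ∨ x ∈ S) ∧
      ∃ (XT : Scheme.{0}) (π : XT ⟶ (O : Scheme.{0})), IsProper π ∧ P XT ∧
        IsIso (π ∣_ (O.ι ⁻¹ᵁ U)) ∧ Dense ((π ⁻¹ᵁ (O.ι ⁻¹ᵁ U) : XT.Opens) : Set XT) := by
    refine Finset.induction_on' (motive := fun T => ∃ (O : X.Opens),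
      (∀ x : X, x ∈ O ↔ x ∈ U ∨ x ∈ T) ∧
      ∃ (XT : Scheme.{0}) (π : XT ⟶ (O : Scheme.{0})), IsProper π ∧ P XT ∧
        IsIso (π ∣_ (O.ι ⁻¹ᵁ U)) ∧ Dense ((π ⁻¹ᵁ (O.ι ⁻¹ᵁ U) : XT.Opens) : Set XT)) S ?_ ?_
    · -- base `T = ∅`: `O = U` with the identity
      refine ⟨U, fun x => by simp, U, 𝟙 _, inferInstance, hU, inferInstance, ?_⟩
      rw [Scheme.Hom.id_preimage, Scheme.Opens.ι_preimage_self, Opens.coe_top]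
      exact dense_univ
    · -- step `T ↦ insert s T`
      intro s T hsS _hTS hsT ih
      obtain ⟨O, hO, hres⟩ := ih
      obtain ⟨V, hsV, hVS, Y, ρ, hρ, hY, hρiso, hρd⟩ := hloc s hsS
      -- the overlap `O ∩ V` lies in `U`
      have hOV : O ⊓ V ≤ U := by
        intro x hx
        have hxO : x ∈ O := (Opens.mem_inf.mp hx).1
        have hxV : x ∈ V := (Opens.mem_inf.mp hx).2
        rcases hcov x with h | h
        · exact h
        · have hxs : x = s := hVS x h hxV
          rw [hxs] at hxO
          rcases (hO s).mp hxO with h' | h'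
          · rw [hxs]
            exact h'
          · exact absurd h' hsT
      refine ⟨O ⊔ V, fun x => ?_,
        exists_model_sup_of_inf_le P hPglue X U O V hOV hres ⟨Y, ρ, hρ, hY, hρiso, hρd⟩⟩
      rw [Opens.mem_sup, hO, Finset.mem_insert]
      constructor
      · rintro ((h | h) | h)
        · exact Or.inl h
        · exact Or.inr (Or.inr h)
        · rcases hcov x with h' | h'
          · exact Or.inl h'
          · exact Or.inr (Or.inl (hVS x h' h))
      · rintro (h | h | h)
        · exact Or.inl (Or.inl h)
        · rw [h]
          exact Or.inr hsV
        · exact Or.inl (Or.inr h)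
  -- Step 2: `O = ⊤`; compose with the isomorphism `⊤.ι : ↑⊤ ⟶ X`.
  obtain ⟨O, hO, XT, π, hπ, hXT, hiso, hd⟩ := key
  have hOtop : O = ⊤ := top_le_iff.mp fun x _ => (hO x).mpr (hcov x)
  subst hOtop
  haveI := hπ
  haveI hι : IsIso (⊤ : X.Opens).ι := by
    show IsIso X.topIso.hom
    infer_instance
  refine ⟨XT, π ≫ (⊤ : X.Opens).ι, inferInstance, hXT, ?_, ?_⟩
  · haveI h1 : IsIso (π ∣_ ((⊤ : X.Opens).ι ⁻¹ᵁ U)) := hiso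
    have h12 : IsIso ((π ∣_ ((⊤ : X.Opens).ι ⁻¹ᵁ U)) ≫ ((⊤ : X.Opens).ι ∣_ U)) :=
      IsIso.comp_isIso
    rw [morphismRestrict_comp]
    exact h12
  · rw [Scheme.Hom.comp_preimage]
    exact hd

end Summit.ResolutionOfSingularities.ResolutionOfSingularities.Theorems.FRationalResolution

end
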